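import Literature.Analysis.FunctionSpaces.ItoFormulaProofs
import Literature.Analysis.FunctionSpaces.ItoProcessesProofs
import Literature.Probability.Process.ItoIntegralLinearity
import HarnessLib

/-!
# The product rule `d(XA) = X dA + A dX` for an Itô process and a finite-variation process

Topic `Analysis/FunctionSpaces`; theorems only. For the canonical Brownian motion and its raw
filtration (the setting of `Literature.Analysis.FunctionSpaces.ito_formula_itoProcess_ae`), let
`X = X₀ + ∫ b ds + ∫ σ dB` be a strongly adapted Itô process with progressive `σ`, and let
`A = A₀ + ∫ a ds` be a strongly adapted process of finite variation given as the time integral of a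
locally integrable `a` (e.g. a process with `C¹` paths). Then

  `X_t A_t = X₀ A₀ + ∫₀ᵗ (X_s a_s + A_s b_s) ds + ∫₀ᵗ σ_s A_s dB_s`

almost surely for all `t` (`Literature.Analysis.FunctionSpaces.ae_mul_eq_of_isItoProcess`), and in
particular `XA` is an Itô process with drift `X a + A b` and diffusion coefficient `σ A`
(`IsItoProcess.mul_timeIntegral`). This is the step "the product rule gives `dZ_t = …`" of
Lawler (2005), proof of Prop. 6.33 (`Z = X/(X - Y)` with `d[X - Y]` of finite variation).

Proof (polarisation, from the one-dimensional Itô formula of the tree): `X ± A` are Itô processes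
with drifts `b ± a` and the *same* diffusion coefficient `σ` and Itô integral `J`; Itô's formula
for `u²` gives `(X ± A)² = (X₀ ± A₀)² + ∫ (2(X ± A)(b ± a) + σ²) ds + K±`, where for `K±` we may
take *any* Itô integrals of `2σ(X ± A)`, here `K± = 2K_X ± 2K` built from given (martingale) Itô
integrals `K_X = ∫ σX dB`, `K = ∫ σA dB` by linearity (`IsItoIntegral.add_of_martingale`,
`IsItoIntegral.sub_of_martingale`); subtracting, `4XA = 4X₀A₀ + 4∫ (Xa + Ab) ds + 4K`.

## References

* D. Revuz, M. Yor, *Continuous Martingales and Brownian Motion* (3rd ed., 1999), Ch. IV,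
  Prop. (3.1) (integration by parts `X_tY_t = X₀Y₀ + ∫X dY + ∫Y dX + ⟨X, Y⟩`) and Thm (3.3).
* G. F. Lawler, *Conformally Invariant Processes in the Plane* (2005), §6.7, proof of
  Prop. 6.33 ("The product rule gives `dZ_t = …`").
-/

noncomputable section

open MeasureTheory Filter Topology Set
open scoped NNReal ENNReal

namespace Literature.Analysis.FunctionSpaces

open Literature.Probability.Process Literature.Probability.RandomPlanarGeometry

variable {X b σ A a K KX : ℝ≥0 → (ℝ≥0 → ℝ) → ℝ}

/-- **Adding a finite-variation process to an Itô process**: if `X = X₀ + ∫ b ds + J` is an Itô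
process with diffusion coefficient `σ` and `A = A₀ + ∫ a ds` a.s. (with `a` a.s. locally
integrable), then `X + c A` (`c : ℝ`) is an Itô process with drift `b + c a` and the same
diffusion coefficient (same Itô integral `J`).
Revuz–Yor (1999), Ch. IV, §3 (continuous semimartingales form a vector space). [folklore] -/
theorem IsItoProcess.add_const_mul_timeIntegral
    (hX : IsItoProcess X b σ brownian brownianFiltration preWienerMeasure)
    (hA : ∀ᵐ ω ∂preWienerMeasure, ∀ t : ℝ≥0, A t ω = A 0 ω + ∫ s in (0 : ℝ)..t, a s.toNNReal ω)
    (ha : ∀ᵐ ω ∂preWienerMeasure, ∀ t : ℝ≥0, IntegrableOn (fun s : ℝ ↦ a s.toNNReal ω) (Icc 0 t))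
    (c : ℝ) :
    IsItoProcess (fun t ω ↦ X t ω + c * A t ω) (fun t ω ↦ b t ω + c * a t ω) σ brownian
      brownianFiltration preWienerMeasure := by
  obtain ⟨J, hJ, hXeq⟩ := hX.2
  refine ⟨?_, J, hJ, ?_⟩
  · filter_upwards [hX.1, ha] with ω hb ha t
    exact (hb t).add ((ha t).const_mul c)
  · filter_upwards [hX.1, ha, hXeq, hA] with ω hb ha hXω hAω t
    have hbi : IntervalIntegrable (fun s : ℝ ↦ b s.toNNReal ω) volume 0 t :=
      (intervalIntegrable_iff_integrableOn_Icc_of_le t.coe_nonneg).2 (hb t)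
    have hai : IntervalIntegrable (fun s : ℝ ↦ c * a s.toNNReal ω) volume 0 t :=
      ((intervalIntegrable_iff_integrableOn_Icc_of_le t.coe_nonneg).2 (ha t)).const_mul c
    rw [intervalIntegral.integral_add hbi hai, intervalIntegral.integral_const_mul, hXω t, hAω t]
    ring

/-- **The product rule, integrated form** (`XA = X₀A₀ + ∫ (Xa + Ab) ds + ∫ σA dB`). Let
`X = X₀ + ∫ b ds + ∫ σ dB` be an Itô process (canonical Brownian motion, raw filtration) which is
strongly adapted with continuous paths and progressive `σ`; let `A = A₀ + ∫ a ds` (every `t`,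
a.s.) be strongly adapted with continuous paths, `a` a.s. locally integrable; and let
`K_X = ∫ σX dB`, `K = ∫ σA dB` be Itô integrals which are martingales (e.g. the square-integrable
integrals of `exists_isItoIntegral_of_sq_integrable` for bounded `σX`, `σA`). Then almost surely,
for all `t`, `X_t A_t = X₀A₀ + ∫₀ᵗ (X_s a_s + A_s b_s) ds + K_t`. Proof by polarisation from Itô's
formula for `u²` along `X ± A` (`ito_formula_itoProcess_ae_holds`) with the Itô integrals
`2K_X ± 2K` of `2σ(X ± A)` (`IsItoIntegral.add_of_martingale`, `.sub_of_martingale`).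
Revuz–Yor (1999), Ch. IV, Prop. (3.1); Lawler (2005), proof of Prop. 6.33 ("the product rule
gives …"). [cite: RevuzYor1999, Ch. IV Prop. (3.1)] -/
theorem ae_mul_eq_of_isItoProcess (hXa : StronglyAdapted brownianFiltration X)
    (hXc : ∀ ω, Continuous (X · ω)) (hσ : IsStronglyProgressive brownianFiltration σ)
    (hX : IsItoProcess X b σ brownian brownianFiltration preWienerMeasure)
    (hAa : StronglyAdapted brownianFiltration A) (hAc : ∀ ω, Continuous (A · ω))
    (hA : ∀ᵐ ω ∂preWienerMeasure, ∀ t : ℝ≥0, A t ω = A 0 ω + ∫ s in (0 : ℝ)..t, a s.toNNReal ω)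
    (ha : ∀ᵐ ω ∂preWienerMeasure, ∀ t : ℝ≥0, IntegrableOn (fun s : ℝ ↦ a s.toNNReal ω) (Icc 0 t))
    (hKX : IsItoIntegral (fun t ω ↦ σ t ω * X t ω) brownian KX brownianFiltration preWienerMeasure)
    (hKXM : Martingale KX brownianFiltration preWienerMeasure)
    (hK : IsItoIntegral (fun t ω ↦ σ t ω * A t ω) brownian K brownianFiltration preWienerMeasure)
    (hKM : Martingale K brownianFiltration preWienerMeasure) :
    ∀ᵐ ω ∂preWienerMeasure, ∀ t : ℝ≥0, X t ω * A t ω = X 0 ω * A 0 ω +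
      (∫ s in (0 : ℝ)..t, (X s.toNNReal ω * a s.toNNReal ω + A s.toNNReal ω * b s.toNNReal ω)) +
      K t ω := by
  have hXprog : IsStronglyProgressive brownianFiltration X :=
    hXa.isStronglyProgressive_of_continuous hXc
  have hAprog : IsStronglyProgressive brownianFiltration A :=
    hAa.isStronglyProgressive_of_continuous hAc
  have hσX : ∀ ω, Measurable fun s : ℝ ↦ σ s.toNNReal ω * X s.toNNReal ω := fun ω ↦
    measurable_path_of_isStronglyProgressive (hσ.mul hXprog) ω
  have hσA : ∀ ω, Measurable fun s : ℝ ↦ σ s.toNNReal ω * A s.toNNReal ω := fun ω ↦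
    measurable_path_of_isStronglyProgressive (hσ.mul hAprog) ω
  -- the processes `X ± A`
  have hP : IsItoProcess (fun t ω ↦ X t ω + 1 * A t ω) (fun t ω ↦ b t ω + 1 * a t ω) σ brownian
      brownianFiltration preWienerMeasure := hX.add_const_mul_timeIntegral hA ha 1
  have hM : IsItoProcess (fun t ω ↦ X t ω + (-1) * A t ω) (fun t ω ↦ b t ω + (-1) * a t ω) σ
      brownian brownianFiltration preWienerMeasure := hX.add_const_mul_timeIntegral hA ha (-1)
  have hPa : Adapted brownianFiltration fun t ω ↦ X t ω + 1 * A t ω := fun t ↦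
    ((hXa t).add ((hAa t).const_mul 1)).measurable
  have hMa : Adapted brownianFiltration fun t ω ↦ X t ω + (-1) * A t ω := fun t ↦
    ((hXa t).add ((hAa t).const_mul (-1))).measurable
  have hd1 : ∀ v : ℝ, deriv (fun u : ℝ ↦ u ^ 2) v = 2 * v := fun v ↦ by
    rw [(hasDerivAt_pow 2 v).deriv]; simp [pow_one]
  have hd2 : ∀ v : ℝ, iteratedDeriv 2 (fun u : ℝ ↦ u ^ 2) v = 2 := fun v ↦ by
    rw [iteratedDeriv_succ, iteratedDeriv_one, show deriv (fun u : ℝ ↦ u ^ 2) = fun v ↦ 2 * v from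
      funext hd1, deriv_const_mul _ differentiableAt_id, deriv_id'', mul_one]
  -- Itô integrals of `2σ(X ± A)` by linearity
  have hKP : IsItoIntegral (fun t ω ↦ σ t ω * deriv ((fun (_ : ℝ) (v : ℝ) ↦ v ^ 2) t)
      (X t ω + 1 * A t ω)) brownian (fun t ω ↦ (KX t ω + K t ω) + (KX t ω + K t ω))
      brownianFiltration preWienerMeasure := by
    have h1 := hKX.add_of_martingale hK hσX hσA hKXM hKM
    have h2 := h1.add_of_martingale h1 (fun ω ↦ (hσX ω).add (hσA ω))
      (fun ω ↦ (hσX ω).add (hσA ω)) (hKXM.add hKM) (hKXM.add hKM)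
    have heq : (fun t ω ↦ σ t ω * deriv ((fun (_ : ℝ) (v : ℝ) ↦ v ^ 2) t) (X t ω + 1 * A t ω)) =
        fun t ω ↦ σ t ω * X t ω + σ t ω * A t ω + (σ t ω * X t ω + σ t ω * A t ω) := by
      funext t ω
      beta_reduce
      rw [hd1]
      ring
    rw [heq]
    exact h2
  have hKM' : IsItoIntegral (fun t ω ↦ σ t ω * deriv ((fun (_ : ℝ) (v : ℝ) ↦ v ^ 2) t)
      (X t ω + (-1) * A t ω)) brownian (fun t ω ↦ (KX t ω - K t ω) + (KX t ω - K t ω))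
      brownianFiltration preWienerMeasure := by
    have h1 := hKX.sub_of_martingale hK hσX hσA hKXM hKM
    have h2 := h1.add_of_martingale h1 (fun ω ↦ (hσX ω).sub (hσA ω))
      (fun ω ↦ (hσX ω).sub (hσA ω)) (hKXM.sub hKM) (hKXM.sub hKM)
    have heq : (fun t ω ↦ σ t ω * deriv ((fun (_ : ℝ) (v : ℝ) ↦ v ^ 2) t) (X t ω + (-1) * A t ω)) =
        fun t ω ↦ σ t ω * X t ω - σ t ω * A t ω + (σ t ω * X t ω - σ t ω * A t ω) := by
      funext t ω
      beta_reduce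
      rw [hd1]
      ring
    rw [heq]
    exact h2
  -- Itô's formula for `u²` along `X ± A`
  have hf : ContDiff ℝ 2 (Function.uncurry fun (_ : ℝ) (v : ℝ) ↦ v ^ 2) :=
    (contDiff_id.pow 2).comp contDiff_snd
  have hitoP := ito_formula_itoProcess_ae_holds (fun (_ : ℝ) (v : ℝ) ↦ v ^ 2) hf hPa hσ hP hKP
  have hitoM := ito_formula_itoProcess_ae_holds (fun (_ : ℝ) (v : ℝ) ↦ v ^ 2) hf hMa hσ hM hKM'
  have hintP := hP.ae_integrableOn_itoDrift hf hσ
  have hintM := hM.ae_integrableOn_itoDrift hf hσ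
  filter_upwards [hitoP, hitoM, hintP, hintM, hX.1, ha] with ω hP' hM' hiP hiM hb ha' t
  have h1 := hP' t
  have h2 := hM' t
  have hi1 := hiP t
  have hi2 := hiM t
  simp only [deriv_const, zero_add, hd1, hd2] at h1 h2 hi1 hi2
  -- subtract the two integrals
  have hI1 : IntervalIntegrable (fun s : ℝ ↦ (b s.toNNReal ω + 1 * a s.toNNReal ω) *
      (2 * (X s.toNNReal ω + 1 * A s.toNNReal ω)) + 2⁻¹ * σ s.toNNReal ω ^ 2 * 2) volume 0 t :=
    (intervalIntegrable_iff_integrableOn_Icc_of_le t.coe_nonneg).2 hi1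
  have hI2 : IntervalIntegrable (fun s : ℝ ↦ (b s.toNNReal ω + (-1) * a s.toNNReal ω) *
      (2 * (X s.toNNReal ω + (-1) * A s.toNNReal ω)) + 2⁻¹ * σ s.toNNReal ω ^ 2 * 2) volume 0 t :=
    (intervalIntegrable_iff_integrableOn_Icc_of_le t.coe_nonneg).2 hi2
  have hdiff : (∫ s in (0 : ℝ)..t, ((b s.toNNReal ω + 1 * a s.toNNReal ω) *
      (2 * (X s.toNNReal ω + 1 * A s.toNNReal ω)) + 2⁻¹ * σ s.toNNReal ω ^ 2 * 2)) -
      (∫ s in (0 : ℝ)..t, ((b s.toNNReal ω + (-1) * a s.toNNReal ω) *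
      (2 * (X s.toNNReal ω + (-1) * A s.toNNReal ω)) + 2⁻¹ * σ s.toNNReal ω ^ 2 * 2)) =
      4 * ∫ s in (0 : ℝ)..t, (X s.toNNReal ω * a s.toNNReal ω + A s.toNNReal ω * b s.toNNReal ω) := by
    rw [← intervalIntegral.integral_sub hI1 hI2, ← intervalIntegral.integral_const_mul]
    refine intervalIntegral.integral_congr fun s _ ↦ ?_
    ring
  linear_combination (h1 - h2 + hdiff) / 4

/-- **The product `XA` is an Itô process** with drift `X a + A b` and diffusion coefficient
`σ A` (hypotheses of `ae_mul_eq_of_isItoProcess`, plus a.s. local integrability of `b`-times-`A`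
type products, automatic here since `X`, `A` have continuous paths).
Revuz–Yor (1999), Ch. IV, Prop. (3.1). [cite: RevuzYor1999, Ch. IV Prop. (3.1)] -/
theorem IsItoProcess.mul_timeIntegral (hXa : StronglyAdapted brownianFiltration X)
    (hXc : ∀ ω, Continuous (X · ω)) (hσ : IsStronglyProgressive brownianFiltration σ)
    (hX : IsItoProcess X b σ brownian brownianFiltration preWienerMeasure)
    (hAa : StronglyAdapted brownianFiltration A) (hAc : ∀ ω, Continuous (A · ω))
    (hA : ∀ᵐ ω ∂preWienerMeasure, ∀ t : ℝ≥0, A t ω = A 0 ω + ∫ s in (0 : ℝ)..t, a s.toNNReal ω)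
    (ha : ∀ᵐ ω ∂preWienerMeasure, ∀ t : ℝ≥0, IntegrableOn (fun s : ℝ ↦ a s.toNNReal ω) (Icc 0 t))
    (hKX : IsItoIntegral (fun t ω ↦ σ t ω * X t ω) brownian KX brownianFiltration preWienerMeasure)
    (hKXM : Martingale KX brownianFiltration preWienerMeasure)
    (hK : IsItoIntegral (fun t ω ↦ σ t ω * A t ω) brownian K brownianFiltration preWienerMeasure)
    (hKM : Martingale K brownianFiltration preWienerMeasure) :
    IsItoProcess (fun t ω ↦ X t ω * A t ω) (fun t ω ↦ X t ω * a t ω + A t ω * b t ω)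
      (fun t ω ↦ σ t ω * A t ω) brownian brownianFiltration preWienerMeasure := by
  refine ⟨?_, K, hK, ae_mul_eq_of_isItoProcess hXa hXc hσ hX hAa hAc hA ha hKX hKXM hK hKM⟩
  filter_upwards [hX.1, ha] with ω hb ha' t
  have hXi : ContinuousOn (fun s : ℝ ↦ X s.toNNReal ω) (Icc 0 t) :=
    ((hXc ω).comp continuous_real_toNNReal).continuousOn
  have hAi : ContinuousOn (fun s : ℝ ↦ A s.toNNReal ω) (Icc 0 t) :=
    ((hAc ω).comp continuous_real_toNNReal).continuousOn
  exact ((ha' t).continuousOn_mul hXi isCompact_Icc).add ((hb t).continuousOn_mul hAi isCompact_Icc)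

end Literature.Analysis.FunctionSpaces
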